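import Literature.Computability.Complexity.PaulPippengerSzemerediTrotter1983Branches
import Literature.Computability.Complexity.PaulPippengerSzemerediTrotter1983Flat
import HarnessLib

/-!
# The four-alternation protocol as data: claims, branch entries, check descriptors (PPST 1983, §3)

Literature / complexity toolkit, sixteenth brick of the inline formalization of
Paul–Pippenger–Szemerédi–Trotter 1983 (`PaulPippengerSzemerediTrotter1983.lean`, fact
`PaulEtAl1983_NTIME_not_subset_DTIME`; roadmap Layer 4, assembly, part 1: the SPECIFICATION of
the linear-time verifier, machine-free). The verifier of the `Σ₄` protocol reads
`⟨⟨⟨⟨x, y₁⟩, y₂⟩, y₃⟩, y₄⟩`; this file fixes the abstract content of the four strings and the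
ONE check selected by `y₄`, for the packaged flat program `FlatN.tmN P hP inp out`
(`…Flat.lean`), and proves that passing ALL checks is exactly the branch condition of
`…Protocol.lean` together with the arithmetic side conditions, the initial light data and the
final label:

* `PPSTSpec.Rec K` (one light record: counter, heights, extreme heights, the arithmetic
  witnesses `lo hi cut hib`, the `J` bit, and heavy data meaningful on `J`), `Y1` (`b` and the
  records), `Entry` / `Y3` (heavy data of a branch, by block index), `Q` (check descriptors);
* `TM2Blocks.lastToucher_congr`; `claimOf`, `Jset`, `Aset`, `Hof` — the protocol objects read off
  the data; `lastToucher_fields` (under the arithmetic checks the fields give the claimed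
  last touchers);
* `ArithOK`, `SmallOK` (the size budget `lo, hi ≤ |x| + |recs| · b + 1`, which keeps the
  verifier's two multiplications linear-time on adversarial data), `Check x D j E q` (one check),
  `AllChecks`;
* **`allChecks_sound`**: `AllChecks → ArithAll ∧ SmallAll ∧ BranchOK … ∧ LightInit … ∧ Final`
  (the completeness direction — the honest strings pass — is `…Complete.lean`);
* `TM2Blocks.lastToucher_eq_none_iff` / `lastToucher_eq_some_iff`, `condSim_congr`,
  `condDep_congr'`, `mem_Aset_iff`, `Hof_ent`.

No named fact is introduced (definitions with bodies and theorems only).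

## References

* W. J. Paul, N. Pippenger, E. Szemerédi, W. T. Trotter, *On determinism versus non-determinism
  and related problems*, FOCS 1983, 429–438, §3 [PaulEtAl1983].
* R. Santhanam, *On separators, segregators and time versus space*, CCC 2001, §2 [Santhanam2001].
-/

namespace Literature.Computability.Complexity

open Turing Function TM2Blocks

namespace TM2Blocks

/-- `lastToucher` depends only on `lo`/`hi` below `j`. [folklore] -/
theorem lastToucher_congr {lo hi lo' hi' : ℕ → ℕ} {j : ℕ} (h : ∀ m, m < j → lo m = lo' m ∧ hi m = hi' m)
    (B : ℕ) : lastToucher lo hi j B = lastToucher lo' hi' j B := by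
  unfold lastToucher
  congr 1
  ext m
  simp only [Finset.mem_filter, Finset.mem_range, Touches, and_congr_right_iff]
  intro hm
  rw [(h m hm).1, (h m hm).2]

/-- **No last toucher**: nothing before `j` touches `B`. [folklore] -/
theorem lastToucher_eq_none_iff {lo hi : ℕ → ℕ} {j B : ℕ} :
    lastToucher lo hi j B = none ↔ ∀ m, m < j → ¬ Touches lo hi m B := by
  unfold lastToucher
  change ((Finset.range j).filter fun i => Touches lo hi i B).max = (⊥ : WithBot ℕ) ↔ _
  rw [Finset.max_eq_bot, Finset.filter_eq_empty_iff]
  simp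

/-- **The last toucher characterized**: it is before `j`, touches `B`, and nothing in between
does. [folklore] -/
theorem lastToucher_eq_some_iff {lo hi : ℕ → ℕ} {j B p : ℕ} :
    lastToucher lo hi j B = some p ↔
      p < j ∧ Touches lo hi p B ∧ ∀ m, p < m → m < j → ¬ Touches lo hi m B := by
  constructor
  · exact lastToucher_spec
  · rintro ⟨hp, ht, hno⟩
    rcases hq : lastToucher lo hi j B with _ | p'
    · exact absurd ht (lastToucher_eq_none_iff.1 hq p hp)
    · obtain ⟨hp', ht', hno'⟩ := lastToucher_spec hq
      rcases lt_trichotomy p p' with hlt | rfl | hgt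
      · exact absurd ht' (hno p' hlt hp')
      · rfl
      · exact absurd ht (hno' p hgt hp)

/-- `CondSim` at `u` depends only on claim `u` and the light data of claim `u + 1`. [folklore] -/
theorem condSim_congr {tm : FinTM2} {b : ℕ} {Γ Γ' : ℕ → BlockClaim tm} {u : ℕ} (hu : Γ' u = Γ u)
    (hl : (Γ' (u + 1)).l = (Γ (u + 1)).l) (hv : (Γ' (u + 1)).var = (Γ (u + 1)).var)
    (hh : (Γ' (u + 1)).ht = (Γ (u + 1)).ht) : CondSim b Γ' u ↔ CondSim b Γ u := by
  simp only [CondSim, hu, hl, hv, hh]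

/-- `CondDep` at `u` depends only on claim `u`, the `lo`/`hi` below `u`, and the cuts and end
contents of the last touchers. [folklore] -/
theorem condDep_congr' {tm : FinTM2} {c₀ : tm.Cfg} {b : ℕ} {Γ Γ' : ℕ → BlockClaim tm} {u : ℕ}
    (hu : Γ' u = Γ u)
    (hlh : ∀ m, m < u → ∀ k, (Γ' m).loC b k = (Γ m).loC b k ∧ (Γ' m).hiC b k = (Γ m).hiC b k)
    (hlt : ∀ k B i, (Γ u).loC b k ≤ B → B ≤ (Γ u).hiC b k →
      lastToucher (fun m => (Γ m).loC b k) (fun m => (Γ m).hiC b k) u B = some i →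
        (Γ' i).cutC b k = (Γ i).cutC b k ∧ (Γ' i).efrag k = (Γ i).efrag k) :
    CondDep c₀ b Γ' u ↔ CondDep c₀ b Γ u := by
  have hfun : ∀ k B, lastToucher (fun m => (Γ' m).loC b k) (fun m => (Γ' m).hiC b k) u B =
      lastToucher (fun m => (Γ m).loC b k) (fun m => (Γ m).hiC b k) u B :=
    fun k B => lastToucher_congr (fun m hm => hlh m hm k) B
  unfold CondDep
  rw [hu]
  refine forall_congr' fun k => forall_congr' fun B => forall_congr' fun hlo =>
    forall_congr' fun hhi => ?_
  rw [hfun k B]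
  rcases hc : lastToucher (fun m => (Γ m).loC b k) (fun m => (Γ m).hiC b k) u B with _ | i
  · exact Iff.rfl
  · obtain ⟨h1, h2⟩ := hlt k B i hlo hhi hc
    simp only [h1, h2]

end TM2Blocks

namespace PPSTSpec

/-! ### Data -/

/-- One light record (block `v`): the program counter at the block's start, the start heights,
the claimed extreme heights, the arithmetic witnesses (`lo`, `hi`, `cut = lo β`,
`hib = (hi + 1) β`), the `J` bit, and heavy data (meaningful when the `J` bit is set).
[cite: PaulEtAl1983, §3] -/
structure Rec (K : ℕ) where
  /-- program counter -/
  pc : ℕ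
  /-- start heights -/
  ht : Fin K → ℕ
  /-- minimal boundary heights -/
  mn : Fin K → ℕ
  /-- maximal boundary heights -/
  mx : Fin K → ℕ
  /-- witness: lowest touched height block -/
  lo : Fin K → ℕ
  /-- witness: highest touched height block -/
  hi : Fin K → ℕ
  /-- witness: the cut `lo β` -/
  cut : Fin K → ℕ
  /-- witness: `(hi + 1) β` -/
  hib : Fin K → ℕ
  /-- membership in `J` -/
  jbit : Bool
  /-- start contents above the cut (on `J`) -/
  frag : Fin K → List Bool
  /-- end contents above the cut (on `J`) -/
  efrag : Fin K → List Bool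

/-- The default record (read beyond the list). [folklore] -/
instance {K : ℕ} : Inhabited (Rec K) :=
  ⟨⟨0, fun _ => 0, fun _ => 0, fun _ => 0, fun _ => 0, fun _ => 0, fun _ => 0, fun _ => 0, false,
    fun _ => [], fun _ => []⟩⟩

/-- The first existential string: block length and the records of blocks `0 … N`.
[cite: PaulEtAl1983, §3] -/
structure Y1 (K : ℕ) where
  /-- time block length -/
  b : ℕ
  /-- records of blocks `0 … N` -/
  recs : List (Rec K)

/-- One entry of the second existential string: heavy data of a block `u` of the branch, and,
per stack `k` and offset `off` (height block `B = lo_u k + off`), the claimed LAST TOUCHER of `B`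
before `u` (`lt k off = 0`: none; `p + 1`: block `p`) and a POINTER `ptr k off` to the position in
the string of the toucher's own entry (consulted when the toucher is outside `J`). The pointers
turn the dependency checks into point checks: the verifier never scans. [cite: PaulEtAl1983, §3] -/
structure Entry (K : ℕ) where
  /-- block index -/
  u : ℕ
  /-- start contents above the cut -/
  frag : Fin K → List Bool
  /-- end contents above the cut -/
  efrag : Fin K → List Bool
  /-- claimed last toucher of height block `lo k + off` (`0`: none, `p + 1`: block `p`) -/
  lt : Fin K → Bool → ℕ
  /-- position of the toucher's entry -/
  ptr : Fin K → Bool → ℕ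

/-- The default entry (read beyond the list). [folklore] -/
instance {K : ℕ} : Inhabited (Entry K) := ⟨⟨0, fun _ => [], fun _ => [], fun _ _ => 0, fun _ _ => 0⟩⟩

/-- The second existential string: the entries of the branch. [folklore] -/
abbrev Y3 (K : ℕ) : Type := List (Entry K)

/-- **Check descriptors** (the last universal string). Every check reads at most four segments
of the strings (records by index, entries by position): arithmetic of record `m`; initial light
data; final label; the branch index heads the entries; entry `e` is in range; entries `e`, `e'`
carry distinct indices; re-simulation of the block of entry `e`; initial contents (entry of block
`0`); closure, dependency and "no toucher in between" for the block of entry `e`, stack `k`,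
offset `off` (and block `m`). [cite: PaulEtAl1983, §3] -/
inductive Q (K : ℕ) : Type
  | arith (m : ℕ)
  | lightInit
  | final
  | jInA
  | wf (e : ℕ)
  | distinct (e e' : ℕ)
  | sim (e : ℕ)
  | init (e : ℕ)
  | closed (e : ℕ) (k : Fin K) (off : Bool)
  | dep (e : ℕ) (k : Fin K) (off : Bool)
  | notouch (e : ℕ) (k : Fin K) (off : Bool) (m : ℕ)

/-! ### The protocol objects read off the data -/

section Objects

variable {K : ℕ} (P : AProg Bool (Fin K)) (hP : 0 < P.length) (inp out : Fin K)

/-- The number of the last block. [folklore] -/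
def lastBlock (D : Y1 K) : ℕ := D.recs.length - 1

/-- Record `v` (default beyond the list). [folklore] -/
def rec (D : Y1 K) (v : ℕ) : Rec K := (D.recs[v]?).getD default

/-- The block claim of record `v`. [folklore] -/
def claimOf (D : Y1 K) (v : ℕ) : BlockClaim (FlatN.tmN P hP inp out) :=
  { l := FlatN.lbl P (rec D v).pc
    var := none
    ht := (rec D v).ht
    mn := (rec D v).mn
    mx := (rec D v).mx
    frag := (rec D v).frag
    efrag := (rec D v).efrag }

/-- The set `J`. [folklore] -/
def Jset (D : Y1 K) : Finset ℕ := (Finset.range D.recs.length).filter fun v => (rec D v).jbit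

/-- The branch set `A`. [folklore] -/
def Aset (E : Y3 K) : Finset ℕ := (E.map Entry.u).toFinset

/-- The heavy data of the branch. [folklore] -/
def Hof (E : Y3 K) (u : ℕ) : Heavy (FlatN.tmN P hP inp out) :=
  match E.find? fun e => e.u = u with
  | some e => (e.frag, e.efrag)
  | none => (fun _ => [], fun _ => [])

/-- The initial configuration on input `x`. [folklore] -/
def cfg₀ (x : List Bool) : (FlatN.tmN P hP inp out).Cfg :=
  FlatN.cfgN P hP inp out ⟨0, AStore.single inp x⟩

/-- Entry at position `e` (default beyond the list). [folklore] -/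
def ent (E : Y3 K) (e : ℕ) : Entry K := (E[e]?).getD default

/-- Record `m` claims to touch height block `B` on stack `k` (read off the FIELDS). [folklore] -/
def Tch (D : Y1 K) (k : Fin K) (m B : ℕ) : Prop := (rec D m).lo k ≤ B ∧ B ≤ (rec D m).hi k

/-- The height block of entry `e`, stack `k`, offset `off`. [folklore] -/
def Bof (D : Y1 K) (E : Y3 K) (e : ℕ) (k : Fin K) (off : Bool) : ℕ :=
  (rec D (ent E e).u).lo k + off.toNat

/-- **The start contents of the block of entry `e` as the verifier reads them**: from the record
when its `J` bit is set, from the entry otherwise. [folklore] -/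
def locFrag (D : Y1 K) (E : Y3 K) (e : ℕ) : Fin K → List Bool := fun k =>
  if (rec D (ent E e).u).jbit then (rec D (ent E e).u).frag k else (ent E e).frag k

/-- The end contents of the block of entry `e` as the verifier reads them. [folklore] -/
def locEfrag (D : Y1 K) (E : Y3 K) (e : ℕ) : Fin K → List Bool := fun k =>
  if (rec D (ent E e).u).jbit then (rec D (ent E e).u).efrag k else (ent E e).efrag k

/-- **The end contents of the claimed toucher `p` as the verifier reads them**: from record `p`
when its `J` bit is set, from the pointed entry otherwise. [folklore] -/
def tEfrag (D : Y1 K) (E : Y3 K) (e : ℕ) (k : Fin K) (off : Bool) (p : ℕ) : List Bool :=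
  if (rec D p).jbit then (rec D p).efrag k else (ent E ((ent E e).ptr k off)).efrag k

/-- The claim family seen by the re-simulation check of entry `e`: the global light data, the
heavy data of the block of `e` as the verifier reads them. [folklore] -/
def locFam (D : Y1 K) (E : Y3 K) (e : ℕ) : ℕ → BlockClaim (FlatN.tmN P hP inp out) := fun v =>
  if v = (ent E e).u then
    { claimOf P hP inp out D v with frag := locFrag D E e, efrag := locEfrag D E e }
  else claimOf P hP inp out D v

/-! ### The checks -/

/-- The arithmetic witnesses of record `m` are right, and at most two height blocks are touched.
[folklore] -/
def ArithOK (D : Y1 K) (m : ℕ) : Prop :=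
  ∀ k, (rec D m).lo k = (claimOf P hP inp out D m).loC D.b k ∧
    (rec D m).hi k = (claimOf P hP inp out D m).hiC D.b k ∧
    (rec D m).cut k = (claimOf P hP inp out D m).cutC D.b k ∧
    (rec D m).hib k = ((claimOf P hP inp out D m).hiC D.b k + 1) * blockβ (FlatN.tmN P hP inp out) D.b ∧
    (rec D m).hi k ≤ (rec D m).lo k + 1

/-- All records have right arithmetic witnesses. [folklore] -/
def ArithAll (D : Y1 K) : Prop := ∀ m, m < D.recs.length → ArithOK P hP inp out D m

/-- **The size budget of record `m`**: the claimed `lo` and `hi` are at most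
`|x| + (number of records) · b + 1` — true of honest data (heights grow by at most one per step),
and what keeps the verifier's multiplications `lo · β`, `(hi + 1) · β` within linear time on
adversarial data (it normalizes the two fields and compares lengths before multiplying).
[folklore] -/
def SmallOK (x : List Bool) (D : Y1 K) (m : ℕ) : Prop :=
  ∀ k, (rec D m).lo k ≤ x.length + D.recs.length * D.b + 1 ∧
    (rec D m).hi k ≤ x.length + D.recs.length * D.b + 1

/-- All records are within the size budget. [folklore] -/
def SmallAll (x : List Bool) (D : Y1 K) : Prop := ∀ m, m < D.recs.length → SmallOK x D m

/-- The final label is the accepting one. [folklore] -/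
def Final (acc : ℕ) (D : Y1 K) : Prop := (rec D (lastBlock D)).pc = acc

/-- **One check** of branch `j` on input `x`, global data `D`, branch data `E`. Every clause reads
boundedly many records (by index) and entries (by position) and does arithmetic on their fields.
[cite: PaulEtAl1983, §3] -/
def Check (acc : ℕ) (x : List Bool) (D : Y1 K) (j : ℕ) (E : Y3 K) : Q K → Prop
  | .arith m => m < D.recs.length → ArithOK P hP inp out D m ∧ SmallOK x D m
  | .lightInit => (rec D 0).pc = 0 ∧ ∀ k, (rec D 0).ht k = ((cfg₀ P hP inp out x).stk k).length
  | .final => Final acc D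
  | .jInA => ∃ en tl, E = en :: tl ∧ en.u = j
  | .wf e => e < E.length → (ent E e).u ≤ lastBlock D
  | .distinct e e' => e < e' → e' < E.length → (ent E e).u ≠ (ent E e').u
  | .sim e => e < E.length → (ent E e).u < lastBlock D →
      (ArithOK P hP inp out D (ent E e).u ∧ SmallOK x D (ent E e).u) ∧
        CondSim D.b (locFam P hP inp out D E e) (ent E e).u
  | .init e => e < E.length → (ent E e).u = 0 →
      ∀ k, locFrag D E e k = above ((rec D 0).cut k) ((cfg₀ P hP inp out x).stk k)
  | .closed e k off => e < E.length → (ent E e).u ≤ lastBlock D →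
      (rec D (ent E e).u).lo k + off.toNat ≤ (rec D (ent E e).u).hi k →
        ∀ p, (ent E e).lt k off = p + 1 → p ≤ lastBlock D → (rec D p).jbit = false →
          (ent E e).ptr k off < E.length ∧ (ent E ((ent E e).ptr k off)).u = p
  | .dep e k off => e < E.length → (ent E e).u ≤ lastBlock D →
      (rec D (ent E e).u).lo k + off.toNat ≤ (rec D (ent E e).u).hi k →
        (ArithOK P hP inp out D (ent E e).u ∧ SmallOK x D (ent E e).u) ∧
        match (ent E e).lt k off with
        | 0 => bpartAbove (blockβ (FlatN.tmN P hP inp out) D.b) ((rec D (ent E e).u).cut k)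
            (Bof D E e k off) (locFrag D E e k) =
            bpart (blockβ (FlatN.tmN P hP inp out) D.b) (Bof D E e k off) ((cfg₀ P hP inp out x).stk k)
        | p + 1 => p < (ent E e).u ∧ Tch D k p (Bof D E e k off) ∧
            (ArithOK P hP inp out D p ∧ SmallOK x D p) ∧
            bpartAbove (blockβ (FlatN.tmN P hP inp out) D.b) ((rec D (ent E e).u).cut k)
              (Bof D E e k off) (locFrag D E e k) =
            bpartAbove (blockβ (FlatN.tmN P hP inp out) D.b) ((rec D p).cut k) (Bof D E e k off)
              (tEfrag D E e k off p)
  | .notouch e k off m => e < E.length → (ent E e).u ≤ lastBlock D →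
      (rec D (ent E e).u).lo k + off.toNat ≤ (rec D (ent E e).u).hi k → m < (ent E e).u →
        (ent E e).lt k off ≤ m → ¬ Tch D k m (Bof D E e k off)

/-- All checks pass. [folklore] -/
def AllChecks (acc : ℕ) (x : List Bool) (D : Y1 K) (j : ℕ) (E : Y3 K) : Prop :=
  ∀ q, Check P hP inp out acc x D j E q

/-- Well-formedness of the branch data: indices at most `N` (a consequence of the `wf` checks).
[folklore] -/
def WF3 (D : Y1 K) (E : Y3 K) : Prop := ∀ e ∈ E, e.u ≤ lastBlock D

/-! ### All checks = the branch condition -/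

variable {P hP inp out}

/-- The claimed `loC` is the record's `lo` under the arithmetic check. [folklore] -/
theorem loC_claimOf {D : Y1 K} {m : ℕ} (h : ArithOK P hP inp out D m) (k : Fin K) :
    (claimOf P hP inp out D m).loC D.b k = (rec D m).lo k := ((h k).1).symm

/-- The claimed `hiC` is the record's `hi` under the arithmetic check. [folklore] -/
theorem hiC_claimOf {D : Y1 K} {m : ℕ} (h : ArithOK P hP inp out D m) (k : Fin K) :
    (claimOf P hP inp out D m).hiC D.b k = (rec D m).hi k := ((h k).2.1).symm

/-- The claimed cut is the record's `cut` under the arithmetic check. [folklore] -/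
theorem cutC_claimOf {D : Y1 K} {m : ℕ} (h : ArithOK P hP inp out D m) (k : Fin K) :
    (claimOf P hP inp out D m).cutC D.b k = (rec D m).cut k := ((h k).2.2.1).symm

/-- Under the arithmetic checks the last touchers read off the fields are the claimed ones.
[folklore] -/
theorem lastToucher_fields {D : Y1 K} (hA : ArithAll P hP inp out D) {u : ℕ}
    (hu : u ≤ D.recs.length) (k : Fin K) (B : ℕ) :
    lastToucher (fun m => (rec D m).lo k) (fun m => (rec D m).hi k) u B =
      lastToucher (fun m => (claimOf P hP inp out D m).loC D.b k)
        (fun m => (claimOf P hP inp out D m).hiC D.b k) u B :=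
  lastToucher_congr (fun m hm => ⟨(loC_claimOf (hA m (by omega)) k).symm,
    (hiC_claimOf (hA m (by omega)) k).symm⟩) B

/-- Members of `A` are at most `N` under well-formedness. [folklore] -/
theorem le_lastBlock_of_mem_Aset {D : Y1 K} {E : Y3 K} (hE : WF3 D E) {u : ℕ} (hu : u ∈ Aset E) :
    u ≤ lastBlock D := by
  unfold Aset at hu
  simp only [List.mem_toFinset, List.mem_map] at hu
  obtain ⟨e, he, rfl⟩ := hu
  exact hE e he

/-- The initial configuration's label and state. [folklore] -/
theorem cfg₀_l (x : List Bool) : (cfg₀ P hP inp out x).l = FlatN.lbl P 0 := rfl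

/-- Entries in range are members of the list. [folklore] -/
theorem ent_eq_getElem {E : Y3 K} {e : ℕ} (he : e < E.length) : ent E e = E[e] := by
  unfold ent; rw [List.getElem?_eq_getElem he]; rfl

/-- The branch set is the set of indices of the entries. [folklore] -/
theorem mem_Aset_iff {E : Y3 K} {u : ℕ} : u ∈ Aset E ↔ ∃ e, e < E.length ∧ (ent E e).u = u := by
  simp only [Aset, List.mem_toFinset, List.mem_map]
  constructor
  · rintro ⟨en, hen, rfl⟩
    obtain ⟨e, he, rfl⟩ := List.mem_iff_getElem.1 hen
    exact ⟨e, he, by rw [ent_eq_getElem he]⟩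
  · rintro ⟨e, he, rfl⟩
    exact ⟨E[e], List.getElem_mem he, by rw [ent_eq_getElem he]⟩

/-- **With distinct indices the heavy data of the block of entry `e` are those of entry `e`.**
[folklore] -/
theorem Hof_ent {E : Y3 K} (hdis : ∀ e e', e < e' → e' < E.length → (ent E e).u ≠ (ent E e').u)
    {e : ℕ} (he : e < E.length) :
    Hof P hP inp out E (ent E e).u = ((ent E e).frag, (ent E e).efrag) := by
  have hfind : E.find? (fun en => decide (en.u = (ent E e).u)) = some (ent E e) := by
    rw [List.find?_eq_some_iff_append]
    refine ⟨by simp, E.take e, E.drop (e + 1), ?_, ?_⟩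
    · rw [ent_eq_getElem he]
      simp
    · intro en hen
      rw [List.mem_iff_getElem] at hen
      obtain ⟨i, hi, rfl⟩ := hen
      rw [List.length_take] at hi
      have hi' : i < e := lt_of_lt_of_le hi (Nat.min_le_left _ _)
      have hiE : i < E.length := by omega
      have hne := hdis i e hi' he
      rw [ent_eq_getElem hiE] at hne
      simpa [List.getElem_take] using hne
  unfold Hof
  rw [hfind]

/-- **Soundness of the point checks.** If every check of branch `j` passes, the arithmetic is
right, the sizes are within budget, the branch condition of `…Protocol.lean` holds for the merged
family, the initial light data are right and the final label is accepting. The claimed last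
touchers are the true last touchers of the claimed `lo`/`hi` (a claimed toucher touches and no
later block before `u` does: `dep`, `notouch`; `lastToucher_eq_some_iff`), the pointers certify
closure (`closed`), the pointed entries carry the heavy data the merged family uses (`distinct`,
`Hof_ent`). [cite: PaulEtAl1983, §3] -/
theorem allChecks_sound {acc : ℕ} {x : List Bool} {D : Y1 K} {j : ℕ} {E : Y3 K}
    (hD : D.recs ≠ []) (h : AllChecks P hP inp out acc x D j E) :
    ArithAll P hP inp out D ∧ SmallAll x D ∧
      BranchOK (cfg₀ P hP inp out x) D.b (lastBlock D) (claimOf P hP inp out D) (Jset D) j (Aset E)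
        (Hof P hP inp out E) ∧
      LightInit (cfg₀ P hP inp out x) (claimOf P hP inp out D) ∧ Final acc D := by
  have hlen : lastBlock D < D.recs.length := by
    unfold lastBlock
    have : 0 < D.recs.length := List.length_pos_iff.2 hD
    omega
  have hA : ArithAll P hP inp out D := fun m hm => (h (.arith m) hm).1
  have hS : SmallAll x D := fun m hm => (h (.arith m) hm).2
  have hdis : ∀ e e', e < e' → e' < E.length → (ent E e).u ≠ (ent E e').u :=
    fun e e' h1 h2 => h (.distinct e e') h1 h2
  have hwf : ∀ e, e < E.length → (ent E e).u ≤ lastBlock D := fun e he => h (.wf e) he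
  have hmem' : ∀ {e}, e < E.length → (ent E e).u ∈ Aset E := fun he => mem_Aset_iff.2 ⟨_, he, rfl⟩
  have hJ : ∀ {v}, v < D.recs.length → (v ∈ Jset D ↔ (rec D v).jbit = true) := by
    intro v hv; simp [Jset, hv]
  -- the merged family
  set M := merge (claimOf P hP inp out D) (Jset D) (Aset E) (Hof P hP inp out E) with hM
  -- at the block of an entry, the merged claim is what the verifier reads
  have hfrag : ∀ {e}, e < E.length → (M (ent E e).u).frag = locFrag D E e ∧
      (M (ent E e).u).efrag = locEfrag D E e := by
    intro e he
    have hu : (ent E e).u < D.recs.length := by have := hwf e he; omega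
    simp only [hM, merge]
    by_cases hj : (rec D (ent E e).u).jbit = true
    · rw [if_neg (fun hh => hh.2 ((hJ hu).2 hj))]
      constructor <;> funext k <;> simp [locFrag, locEfrag, hj, claimOf]
    · rw [if_pos ⟨hmem' he, fun hh => hj ((hJ hu).1 hh)⟩, Hof_ent (P := P) (hP := hP) (inp := inp)
        (out := out) hdis he]
      constructor <;> funext k <;> simp [locFrag, locEfrag, hj]
  have hMu : ∀ {e}, e < E.length → M (ent E e).u = locFam P hP inp out D E e (ent E e).u := by
    intro e he
    obtain ⟨h1, h2⟩ := hfrag he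
    have hl : (M (ent E e).u).l = (claimOf P hP inp out D (ent E e).u).l := merge_l _ _ _ _ _
    have hv : (M (ent E e).u).var = (claimOf P hP inp out D (ent E e).u).var := merge_var _ _ _ _ _
    have hh : (M (ent E e).u).ht = (claimOf P hP inp out D (ent E e).u).ht := merge_ht _ _ _ _ _
    have hmn : (M (ent E e).u).mn = (claimOf P hP inp out D (ent E e).u).mn := merge_mn _ _ _ _ _
    have hmx : (M (ent E e).u).mx = (claimOf P hP inp out D (ent E e).u).mx := merge_mx _ _ _ _ _
    unfold locFam
    rw [if_pos rfl]
    rcases hq : M (ent E e).u with ⟨l, var, ht, mn, mx, frag, efrag⟩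
    rw [hq] at hl hv hh hmn hmx h1 h2
    simp only at hl hv hh hmn hmx h1 h2
    subst hl hv hh hmn hmx h1 h2
    rfl
  -- the end contents of a toucher, as the verifier reads them, are the merged ones
  have htE : ∀ {e}, e < E.length → ∀ k off p,
      (rec D (ent E e).u).lo k + off.toNat ≤ (rec D (ent E e).u).hi k → (ent E e).lt k off = p + 1 →
      p < D.recs.length → (M p).efrag k = tEfrag D E e k off p := by
    intro e he k off p hhi hlt hp
    unfold tEfrag
    by_cases hj : (rec D p).jbit = true
    · have hpJ : p ∈ Jset D := (hJ hp).2 hj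
      rw [hM, merge_of_mem_J _ _ _ _ _ hpJ, if_pos hj]; rfl
    · have hj' : (rec D p).jbit = false := by simpa using hj
      obtain ⟨hptr, hpu⟩ := h (.closed e k off) he (hwf e he) hhi p hlt (by unfold lastBlock; omega) hj'
      rw [if_neg hj]
      have hpA : p ∈ Aset E := by rw [← hpu]; exact hmem' hptr
      have hpJ : p ∉ Jset D := fun hh => hj ((hJ hp).1 hh)
      simp only [hM, merge, if_pos (And.intro hpA hpJ)]
      rw [← hpu, Hof_ent (P := P) (hP := hP) (inp := inp) (out := out) hdis hptr]
  -- the claimed last touchers are the last touchers of the claimed `lo`/`hi`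
  have hLT : ∀ {e}, e < E.length → ∀ k off,
      (rec D (ent E e).u).lo k + off.toNat ≤ (rec D (ent E e).u).hi k → (ent E e).u ≤ lastBlock D →
      lastToucher (fun m => (rec D m).lo k) (fun m => (rec D m).hi k) (ent E e).u (Bof D E e k off) =
        match (ent E e).lt k off with | 0 => none | p + 1 => some p := by
    intro e he k off hhi huN
    rcases hc : (ent E e).lt k off with _ | p
    · simp only
      rw [lastToucher_eq_none_iff]
      intro m hm
      exact h (.notouch e k off m) he huN hhi hm (by rw [hc]; exact Nat.zero_le _)
    · simp only
      have hdep := (h (.dep e k off) he huN hhi).2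
      rw [hc] at hdep
      obtain ⟨hpu, htch, -, -⟩ := hdep
      rw [lastToucher_eq_some_iff]
      refine ⟨hpu, htch, fun m hpm hmu => ?_⟩
      exact h (.notouch e k off m) he huN hhi hmu (by rw [hc]; exact hpm)
  refine ⟨hA, hS, ⟨?_, ?_, ?_, ?_, ?_⟩, ⟨?_, rfl, (h .lightInit).2⟩, h .final⟩
  · -- `j ∈ A`
    obtain ⟨en, tl, hE, hj⟩ := h .jInA
    rw [mem_Aset_iff]
    exact ⟨0, by rw [hE]; simp, by rw [hE, ← hj]; rfl⟩
  · -- closure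
    intro u hu k B p hlo hhi hlt hpJ
    obtain ⟨e, he, rfl⟩ := mem_Aset_iff.1 hu
    have huN := hwf e he
    have har := hA (ent E e).u (by omega)
    rw [loC_claimOf har] at hlo
    rw [hiC_claimOf har] at hhi
    have htwo := (har k).2.2.2.2
    obtain ⟨off, rfl⟩ : ∃ off : Bool, B = (rec D (ent E e).u).lo k + off.toNat := by
      rcases Nat.eq_or_lt_of_le hlo with h0 | h0
      · exact ⟨false, by simp [h0]⟩
      · exact ⟨true, by simp; omega⟩
    rw [← lastToucher_fields hA (u := (ent E e).u) (by omega) k] at hlt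
    have hL := hLT he k off hhi huN
    unfold Bof at hL
    rw [hlt] at hL
    rcases hc : (ent E e).lt k off with _ | p'
    · rw [hc] at hL; simp at hL
    · rw [hc] at hL
      simp only [Option.some.injEq] at hL
      subst hL
      have hp : p < D.recs.length := by have := (lastToucher_spec hlt).1; omega
      have hj' : (rec D p).jbit = false := by
        by_contra hh
        exact hpJ ((hJ hp).2 (by simpa using hh))
      obtain ⟨hptr, hpu⟩ := h (.closed e k off) he huN hhi p hc (by unfold lastBlock; omega) hj'
      rw [← hpu]; exact hmem' hptr
  · -- re-simulation
    intro u hu huN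
    obtain ⟨e, he, rfl⟩ := mem_Aset_iff.1 hu
    have hsim := (h (.sim e) he huN).2
    have e1 : locFam P hP inp out D E e ((ent E e).u + 1) = claimOf P hP inp out D ((ent E e).u + 1) := by
      unfold locFam; rw [if_neg (by omega)]
    rw [← condSim_congr (Γ := M) (hMu he).symm (by rw [e1, hM, merge_l]) (by rw [e1, hM, merge_var])
      (by rw [e1, hM, merge_ht])]
    exact hsim
  · -- dependencies
    intro u hu huN k B hlo hhi
    obtain ⟨e, he, rfl⟩ := mem_Aset_iff.1 hu
    have har := hA (ent E e).u (by omega)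
    simp only [cutC_merge, loC_merge, hiC_merge] at hlo hhi ⊢
    rw [loC_claimOf har] at hlo
    rw [hiC_claimOf har] at hhi
    have htwo := (har k).2.2.2.2
    obtain ⟨off, rfl⟩ : ∃ off : Bool, B = (rec D (ent E e).u).lo k + off.toNat := by
      rcases Nat.eq_or_lt_of_le hlo with h0 | h0
      · exact ⟨false, by simp [h0]⟩
      · exact ⟨true, by simp; omega⟩
    have hdep := (h (.dep e k off) he huN hhi).2
    have hL := hLT he k off hhi huN
    rw [← lastToucher_fields hA (u := (ent E e).u) (by omega) k, cutC_claimOf har]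
    unfold Bof at hL hdep
    rw [hL]
    have hfr : (merge (claimOf P hP inp out D) (Jset D) (Aset E) (Hof P hP inp out E)
        (ent E e).u).frag k = locFrag D E e k := by rw [← hM, (hfrag he).1]
    rw [hfr]
    rcases hc : (ent E e).lt k off with _ | p
    · rw [hc] at hdep; exact hdep
    · rw [hc] at hdep
      obtain ⟨hpu, -, ⟨harp, -⟩, heq⟩ := hdep
      simp only
      rw [cutC_claimOf harp, ← hM, htE he k off p hhi hc (by omega)]
      exact heq
  · -- initial contents
    intro h0 k
    obtain ⟨e, he, hu0⟩ := mem_Aset_iff.1 h0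
    have := h (.init e) he hu0 k
    rw [cutC_claimOf (hA 0 (List.length_pos_iff.2 hD))]
    have hfr := (hfrag he).1
    rw [hu0, hM] at hfr
    rw [hfr]
    exact this
  · -- initial label
    show FlatN.lbl P (rec D 0).pc = _
    rw [(h .lightInit).1]; rfl

/-- In-range entries are at most `N` under the `wf` checks. [folklore] -/
theorem wf3_of_allChecks {acc : ℕ} {x : List Bool} {D : Y1 K} {j : ℕ} {E : Y3 K}
    (h : AllChecks P hP inp out acc x D j E) : WF3 D E := by
  intro en hen
  rw [List.mem_iff_getElem] at hen
  obtain ⟨e, he, rfl⟩ := hen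
  have := h (.wf e) he
  rwa [ent_eq_getElem he] at this

end Objects

end PPSTSpec

end Literature.Computability.Complexity
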